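import Summits.QuantumFields.YangMills.Theorems.FluctuationComparisonRegPrIntLS2BetaSqrtLRecursion
import HarnessLib

/-!
# The `√L` recursion WITH FEEDBACK FROM THE FINER LEVELS — a fixed point, not a triangular recursion:
# `B m = 0`, `B t ≤ √L(1+ε_t)·B (t+1) + C(√L)^t·S + Σ_{u≤t} W t u·B u` and `exp E·Σ_{j<m}Σ_{u≤j} (√L)^{j−u}·W j u ≤ ½`
# ⟹ `B t·(√L)^t ≤ 2·exp E·C·S·L^m∕(L − 1)` at EVERY level (the homogeneous bound of ✓`recursion_varRatio_sqrtL_le_pow`, DOUBLED)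

Cell `ym3-torus` (rung R3 = continuum `SU(2)` Yang–Mills on the three-torus — NOT d = 4, NOT infinite volume, NOT a mass gap, NOT Clay).
Width seat «width 12» `ym3-torus-px12` (gen 24); `--kind proof --supports stmt-QuantumFields-20520 --as helper`, count-neutral, DEFINITION-FREE
(0 `def`, 0 `instance`, 0 `notation`, 0 `sorry`, default heartbeats).  Mathlib-only real-sequence algebra over px16 g20's ✓`…S2BetaSqrtLRecursion`
(`recursion_varRatio_le_prod_mul_add_sum`, `prod_mul_one_add_le_pow_mul_exp_of_sum_le`, `geom_sum_le_pow_div`).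

WHY (this seat's FINDING 13:07:55Z, UV3-NODE §84 follow-up).  On the (D♮)∕(D-stage) REL-TEL road the two-tower level energies `B_t` obey the `√L`
recursion of ✓p822621 `dockRel_inner`, but the RELATIVE KEY LEMMA's commutator junk («SIZE × ARC», px10 g23 §82, ✓p822074 `dist1_rel_conj_le`) is
SIZE_u × the level-`u` RELATIVE BOND DEVIATIONS — the recursion's own `B_u` at the FINER levels `u < t` — propagated to level `t` with the weight
`(√L)^{t−1−u}`.  So the honest system is `B t ≤ √L(1+ε_t)B(t+1) + C(√L)^t·S + Σ_{u≤t} W t u·B u` with `B m = 0`: the unknowns feed back from below, and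
no top-down induction closes it.  THIS FILE closes it as a FIXED POINT: with `M* := max_{t≤m} B t·(√L)^t`, unrolling from ANY height (px16's
`recursion_varRatio_le_prod_mul_add_sum`) gives `M* ≤ exp E·C·S·L^m∕(L−1) + M*·exp E·Σ_{j<m}Σ_{u≤j}(√L)^{j−u}·W j u`, so the displayed smallness
`exp E·ΣΣ(√L)^{j−u}W ≤ ½` yields `M* ≤ 2·exp E·C·S·L^m∕(L−1)`.  In the T³ reading `W j u = c·SIZE_u·(√L)^{j−1−u}` with SIZE from the BACKGROUND tower
(`∝ θ_J·L^{2u}·L^{−2m}`) the double sum is `O(θ_J)` DEPTH-FREE; with the history's thresholds or with a `(√L)^j`-weight it grows like `√(L^m)` (bus count).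
* §1 `sum_shift_le_of_nonneg` (a shifted partial sum is below the full sum), `prod_shift_le_pow_mul_exp` (the shifted ratio product `≤ (√L)^i·exp E`).
* §2 ★★ `unroll_from` — `B t·(√L)^t ≤ exp E·C·S·L^m∕(L−1) + M·exp E·Σ_{j<m}Σ_{u≤j}(√L)^{j−u}·W j u` whenever `B u·(√L)^u ≤ M` at every level.
* §3 ★★★ `recursion_feedback_sqrtL_le` — the fixed point: every `B t·(√L)^t ≤ 2·exp E·C·S·L^m∕(L−1)`; `recursion_feedback_sqrtL_le_zero` (`t = 0`).

HONEST SCOPE.  Elementary inequalities; nothing of Bałaban's analysis is asserted ([Balaban1985RegularSpaces] (1.29) p.81, Lemma 1 p.79 are where the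
relative sizes live); the T³ instantiation (BKG-tower sizes, the sharp weights) is NOT supplied here; (H♭), (D-stage), GAP♯∘, S2β, crux 20520 and
`YM3TorusSU2` are NOT proved; rung R3 = SU(2) YM₃ on T³ — NOT d = 4, NOT infinite volume, NOT a mass gap, NOT Clay; the Yang–Mills mass gap is NOT proved.
-/

set_option autoImplicit false

namespace Summit.QuantumFields.YangMills.Theorems.FluctuationComparisonRegPrIntLS2BetaFeedbackRecursion

open Finset
open Summit.QuantumFields.YangMills.Theorems.FluctuationComparisonRegPrIntLS2BetaSqrtLRecursion
  (recursion_varRatio_le_prod_mul_add_sum prod_mul_one_add_le_pow_mul_exp_of_sum_le geom_sum_le_pow_div)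

/-! ## §1. Shifted sums and products -/

/-- A shifted partial sum of a nonnegative sequence is below the full sum: `Σ_{i<m−t} f (t+i) ≤ Σ_{j<m} f j`. [folklore] -/
theorem sum_shift_le_of_nonneg (f : ℕ → ℝ) (hf : ∀ j, 0 ≤ f j) (m t : ℕ) :
    ∑ i ∈ range (m - t), f (t + i) ≤ ∑ j ∈ range m, f j := by
  rcases le_or_gt t m with ht | ht
  · rw [← Finset.sum_Ico_eq_sum_range, Finset.range_eq_Ico]
    exact Finset.sum_le_sum_of_subset_of_nonneg (Finset.Ico_subset_Ico_left (Nat.zero_le t)) fun j _ _ => hf j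
  · rw [Nat.sub_eq_zero_of_le ht.le, Finset.sum_range_zero]
    exact sum_nonneg fun j _ => hf j

/-- The shifted ratio product: `Π_{l<i} √L(1 + ε (t+l)) ≤ (√L)^i·exp E` for `t + i ≤ m`, `Σ_{j<m} ε j ≤ E`, `ε ≥ 0`. [folklore] -/
theorem prod_shift_le_pow_mul_exp (L : ℝ) (ε : ℕ → ℝ) (hε : ∀ j, 0 ≤ ε j) (m : ℕ) (E : ℝ)
    (hE : ∑ j ∈ range m, ε j ≤ E) (t i : ℕ) (hti : t + i ≤ m) :
    ∏ l ∈ range i, Real.sqrt L * (1 + ε (t + l)) ≤ Real.sqrt L ^ i * Real.exp E := by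
  have hE' : ∑ l ∈ range (m - t), ε (t + l) ≤ E := (sum_shift_le_of_nonneg ε hε m t).trans hE
  exact prod_mul_one_add_le_pow_mul_exp_of_sum_le (Real.sqrt L) (Real.sqrt_nonneg L) (fun l => ε (t + l)) (fun l => hε _)
    (m - t) E hE' i (by omega)

/-! ## §2. Unrolling from an arbitrary height against a uniform weighted bound -/

/-- ★★ **UNROLLING FROM HEIGHT `t`**: if `B m = 0`, `0 ≤ B`, the feedback recursion holds, and `B u·(√L)^u ≤ M` at every `u ≤ m` (`0 ≤ M`), then
`B t·(√L)^t ≤ exp E·C·S·(L^m∕(L−1)) + M·(exp E·Σ_{j<m}Σ_{u≤j}(√L)^{j−u}·W j u)` for every `t ≤ m`. [folklore] -/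
theorem unroll_from (L : ℝ) (hL : 1 < L) (B ε : ℕ → ℝ) (W : ℕ → ℕ → ℝ) (m : ℕ) (hBm : B m = 0) (hB0 : ∀ t, 0 ≤ B t)
    (hε : ∀ t, 0 ≤ ε t) (E : ℝ) (hE : ∑ t ∈ range m, ε t ≤ E) (hW : ∀ j u, 0 ≤ W j u) (C S : ℝ) (hC : 0 ≤ C) (hS : 0 ≤ S)
    (hrec : ∀ t, t < m → B t ≤ Real.sqrt L * (1 + ε t) * B (t + 1) + (C * Real.sqrt L ^ t * S + ∑ u ∈ range (t + 1), W t u * B u))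
    (M : ℝ) (hM0 : 0 ≤ M) (hM : ∀ u, u ≤ m → B u * Real.sqrt L ^ u ≤ M) (t : ℕ) (ht : t ≤ m) :
    B t * Real.sqrt L ^ t ≤ Real.exp E * C * S * (L ^ m / (L - 1)) +
      M * (Real.exp E * ∑ j ∈ range m, ∑ u ∈ range (j + 1), Real.sqrt L ^ (j - u) * W j u) := by
  have hL0 : (0 : ℝ) ≤ L := by linarith
  have hsL : 0 ≤ Real.sqrt L := Real.sqrt_nonneg L
  have hsq : Real.sqrt L ^ 2 = L := Real.sq_sqrt hL0
  set q : ℕ → ℝ := fun t => Real.sqrt L * (1 + ε t) with hq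
  set R : ℕ → ℝ := fun t => C * Real.sqrt L ^ t * S + ∑ u ∈ range (t + 1), W t u * B u with hR
  have hq0 : ∀ t, 0 ≤ q t := fun t => mul_nonneg hsL (by linarith [hε t])
  have hR0 : ∀ t, 0 ≤ R t := fun t => add_nonneg (by positivity) (sum_nonneg fun u _ => mul_nonneg (hW _ _) (hB0 _))
  -- px16's unrolling from `s := t` over `k := m − t` steps; the boundary term vanishes (`B m = 0`)
  have hun := recursion_varRatio_le_prod_mul_add_sum q B R hq0 t (m - t) (fun u hu1 hu2 => hrec u (by omega))
  have htop : B (t + (m - t)) = 0 := by rw [show t + (m - t) = m by omega, hBm]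
  rw [htop, mul_zero, zero_add] at hun
  -- each unrolled term, scaled by `(√L)^t`
  have hterm : ∀ i ∈ range (m - t), Real.sqrt L ^ t * ((∏ l ∈ range i, q (t + l)) * R (t + i)) ≤
      Real.exp E * C * S * L ^ (t + i) + M * (Real.exp E * ∑ u ∈ range (t + i + 1), Real.sqrt L ^ (t + i - u) * W (t + i) u) := by
    intro i hi
    have hi' : t + i ≤ m := by have := mem_range.mp hi; omega
    have hP : ∏ l ∈ range i, q (t + l) ≤ Real.sqrt L ^ i * Real.exp E := prod_shift_le_pow_mul_exp L ε hε m E hE t i hi'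
    have hP0 : 0 ≤ ∏ l ∈ range i, q (t + l) := prod_nonneg fun l _ => hq0 _
    -- the source part
    have h1 : Real.sqrt L ^ t * (Real.sqrt L ^ i * Real.exp E) * (C * Real.sqrt L ^ (t + i) * S) = Real.exp E * C * S * L ^ (t + i) := by
      have : Real.sqrt L ^ t * Real.sqrt L ^ i * Real.sqrt L ^ (t + i) = L ^ (t + i) := by
        rw [← pow_add, ← pow_add, show t + i + (t + i) = 2 * (t + i) by ring, pow_mul, hsq]
      calc Real.sqrt L ^ t * (Real.sqrt L ^ i * Real.exp E) * (C * Real.sqrt L ^ (t + i) * S)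
          = Real.exp E * C * S * (Real.sqrt L ^ t * Real.sqrt L ^ i * Real.sqrt L ^ (t + i)) := by ring
        _ = Real.exp E * C * S * L ^ (t + i) := by rw [this]
    -- the feedback part: `(√L)^{t+i}·W·B u = (√L)^{t+i−u}·W·(B u·(√L)^u) ≤ (√L)^{t+i−u}·W·M`
    have h2 : Real.sqrt L ^ t * (Real.sqrt L ^ i * Real.exp E) * (∑ u ∈ range (t + i + 1), W (t + i) u * B u) ≤
        M * (Real.exp E * ∑ u ∈ range (t + i + 1), Real.sqrt L ^ (t + i - u) * W (t + i) u) := by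
      rw [mul_sum, mul_sum, mul_sum]
      refine sum_le_sum fun u hu => ?_
      have hu' : u < t + i + 1 := mem_range.mp hu
      have hpow : Real.sqrt L ^ t * Real.sqrt L ^ i = Real.sqrt L ^ (t + i - u) * Real.sqrt L ^ u := by
        rw [← pow_add, ← pow_add, show t + i - u + u = t + i by omega]
      have hBu := hM u (by omega)
      calc Real.sqrt L ^ t * (Real.sqrt L ^ i * Real.exp E) * (W (t + i) u * B u)
          = Real.exp E * W (t + i) u * (Real.sqrt L ^ t * Real.sqrt L ^ i) * B u := by ring
        _ = Real.exp E * W (t + i) u * Real.sqrt L ^ (t + i - u) * (B u * Real.sqrt L ^ u) := by rw [hpow]; ring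
        _ ≤ Real.exp E * W (t + i) u * Real.sqrt L ^ (t + i - u) * M :=
            mul_le_mul_of_nonneg_left hBu (by have := hW (t + i) u; positivity)
        _ = M * (Real.exp E * (Real.sqrt L ^ (t + i - u) * W (t + i) u)) := by ring
    calc Real.sqrt L ^ t * ((∏ l ∈ range i, q (t + l)) * R (t + i))
        ≤ Real.sqrt L ^ t * ((Real.sqrt L ^ i * Real.exp E) * R (t + i)) :=
          mul_le_mul_of_nonneg_left (mul_le_mul_of_nonneg_right hP (hR0 _)) (pow_nonneg hsL _)
      _ = Real.sqrt L ^ t * (Real.sqrt L ^ i * Real.exp E) * (C * Real.sqrt L ^ (t + i) * S) +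
            Real.sqrt L ^ t * (Real.sqrt L ^ i * Real.exp E) * (∑ u ∈ range (t + i + 1), W (t + i) u * B u) := by rw [hR]; ring
      _ ≤ Real.exp E * C * S * L ^ (t + i) + M * (Real.exp E * ∑ u ∈ range (t + i + 1), Real.sqrt L ^ (t + i - u) * W (t + i) u) := by
          rw [h1]; exact add_le_add le_rfl h2
  -- sum the terms; both shifted sums are below the full sums
  have hgeo : ∑ i ∈ range (m - t), L ^ (t + i) ≤ L ^ m / (L - 1) :=
    (sum_shift_le_of_nonneg (fun j => L ^ j) (fun j => pow_nonneg hL0 j) m t).trans (geom_sum_le_pow_div L hL m)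
  have hfb : ∑ i ∈ range (m - t), ∑ u ∈ range (t + i + 1), Real.sqrt L ^ (t + i - u) * W (t + i) u ≤
      ∑ j ∈ range m, ∑ u ∈ range (j + 1), Real.sqrt L ^ (j - u) * W j u :=
    sum_shift_le_of_nonneg (fun j => ∑ u ∈ range (j + 1), Real.sqrt L ^ (j - u) * W j u)
      (fun j => sum_nonneg fun u _ => mul_nonneg (pow_nonneg hsL _) (hW j u)) m t
  have hE0 : 0 ≤ Real.exp E * C * S := by positivity
  calc B t * Real.sqrt L ^ t = Real.sqrt L ^ t * B t := mul_comm _ _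
    _ ≤ Real.sqrt L ^ t * ∑ i ∈ range (m - t), (∏ l ∈ range i, q (t + l)) * R (t + i) :=
        mul_le_mul_of_nonneg_left hun (pow_nonneg hsL _)
    _ = ∑ i ∈ range (m - t), Real.sqrt L ^ t * ((∏ l ∈ range i, q (t + l)) * R (t + i)) := by rw [mul_sum]
    _ ≤ ∑ i ∈ range (m - t), (Real.exp E * C * S * L ^ (t + i) +
          M * (Real.exp E * ∑ u ∈ range (t + i + 1), Real.sqrt L ^ (t + i - u) * W (t + i) u)) := sum_le_sum hterm
    _ = Real.exp E * C * S * ∑ i ∈ range (m - t), L ^ (t + i) +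
          M * (Real.exp E * ∑ i ∈ range (m - t), ∑ u ∈ range (t + i + 1), Real.sqrt L ^ (t + i - u) * W (t + i) u) := by
        rw [sum_add_distrib, ← mul_sum, ← mul_sum, ← mul_sum]
    _ ≤ Real.exp E * C * S * (L ^ m / (L - 1)) + M * (Real.exp E * ∑ j ∈ range m, ∑ u ∈ range (j + 1), Real.sqrt L ^ (j - u) * W j u) :=
        add_le_add (mul_le_mul_of_nonneg_left hgeo hE0)
          (mul_le_mul_of_nonneg_left (mul_le_mul_of_nonneg_left hfb (Real.exp_pos E).le) hM0)

/-! ## §3. The fixed point -/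

/-- ★★★ **THE `√L` RECURSION WITH FEEDBACK CLOSES AS A FIXED POINT**: `B m = 0`, `0 ≤ B`,
`B t ≤ √L(1+ε_t)·B (t+1) + C(√L)^t·S + Σ_{u≤t} W t u·B u` (`t < m`), `Σ_{t<m} ε_t ≤ E`, `W ≥ 0`, and the FEEDBACK SMALLNESS
`exp E·Σ_{j<m}Σ_{u≤j}(√L)^{j−u}·W j u ≤ ½` ⟹ `B t·(√L)^t ≤ 2·exp E·C·S·L^m∕(L−1)` at every `t ≤ m` (take the level `t*` maximising `B t·(√L)^t` in §2).
[folklore] -/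
theorem recursion_feedback_sqrtL_le (L : ℝ) (hL : 1 < L) (B ε : ℕ → ℝ) (W : ℕ → ℕ → ℝ) (m : ℕ) (hBm : B m = 0) (hB0 : ∀ t, 0 ≤ B t)
    (hε : ∀ t, 0 ≤ ε t) (E : ℝ) (hE : ∑ t ∈ range m, ε t ≤ E) (hW : ∀ j u, 0 ≤ W j u) (C S : ℝ) (hC : 0 ≤ C) (hS : 0 ≤ S)
    (hrec : ∀ t, t < m → B t ≤ Real.sqrt L * (1 + ε t) * B (t + 1) + (C * Real.sqrt L ^ t * S + ∑ u ∈ range (t + 1), W t u * B u))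
    (hsmall : Real.exp E * ∑ j ∈ range m, ∑ u ∈ range (j + 1), Real.sqrt L ^ (j - u) * W j u ≤ 1 / 2) :
    ∀ t, t ≤ m → B t * Real.sqrt L ^ t ≤ 2 * (Real.exp E * C * S * (L ^ m / (L - 1))) := by
  have hsL : 0 ≤ Real.sqrt L := Real.sqrt_nonneg L
  -- the maximal scaled level energy `M* = B t* · (√L)^{t*}`
  obtain ⟨tstar, htstar, hmax⟩ := Finset.exists_max_image (range (m + 1)) (fun u => B u * Real.sqrt L ^ u) ⟨0, by simp⟩
  set M := B tstar * Real.sqrt L ^ tstar with hM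
  have hM0 : 0 ≤ M := mul_nonneg (hB0 _) (pow_nonneg hsL _)
  have hMall : ∀ u, u ≤ m → B u * Real.sqrt L ^ u ≤ M := fun u hu => hmax u (mem_range.mpr (by omega))
  have htm : tstar ≤ m := by have := mem_range.mp htstar; omega
  -- §2 at `t*`: `M ≤ A + M·Θ ≤ A + M/2`
  have hkey := unroll_from L hL B ε W m hBm hB0 hε E hE hW C S hC hS hrec M hM0 hMall tstar htm
  have hMle : M ≤ 2 * (Real.exp E * C * S * (L ^ m / (L - 1))) := by
    have : M * (Real.exp E * ∑ j ∈ range m, ∑ u ∈ range (j + 1), Real.sqrt L ^ (j - u) * W j u) ≤ M * (1 / 2) :=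
      mul_le_mul_of_nonneg_left hsmall hM0
    rw [← hM] at hkey
    linarith
  intro t ht
  exact (hMall t ht).trans hMle

/-- The bottom level: `B 0 ≤ 2·exp E·C·S·L^m∕(L−1)` — the homogeneous bound of ✓`recursion_varRatio_sqrtL_le_pow`, doubled. [folklore] -/
theorem recursion_feedback_sqrtL_le_zero (L : ℝ) (hL : 1 < L) (B ε : ℕ → ℝ) (W : ℕ → ℕ → ℝ) (m : ℕ) (hBm : B m = 0) (hB0 : ∀ t, 0 ≤ B t)
    (hε : ∀ t, 0 ≤ ε t) (E : ℝ) (hE : ∑ t ∈ range m, ε t ≤ E) (hW : ∀ j u, 0 ≤ W j u) (C S : ℝ) (hC : 0 ≤ C) (hS : 0 ≤ S)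
    (hrec : ∀ t, t < m → B t ≤ Real.sqrt L * (1 + ε t) * B (t + 1) + (C * Real.sqrt L ^ t * S + ∑ u ∈ range (t + 1), W t u * B u))
    (hsmall : Real.exp E * ∑ j ∈ range m, ∑ u ∈ range (j + 1), Real.sqrt L ^ (j - u) * W j u ≤ 1 / 2) :
    B 0 ≤ 2 * (Real.exp E * C * S * (L ^ m / (L - 1))) := by
  have h := recursion_feedback_sqrtL_le L hL B ε W m hBm hB0 hε E hE hW C S hC hS hrec hsmall 0 (Nat.zero_le m)
  rwa [pow_zero, mul_one] at h

end Summit.QuantumFields.YangMills.Theorems.FluctuationComparisonRegPrIntLS2BetaFeedbackRecursion
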